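import Mathlib
import Literature.Analysis.FluidPDE.Tao2016AveragedNS.BoundedEternalSolutions
import Summits.NavierStokesRegularity.NavierStokesRegularity.Theses.WakeRatchet

/-!
# BC3 birth skeleton for crux `TailRatchet` (route WakeRatchet, ns-idea-1 g0) — REGISTERED form:
`TailRatchet_of` concludes the route decl `Summit.…Theses.WakeRatchet.TailRatchet` BY NAME (rev 0, unrestricted).
Split by dissipation level (mirrors the parent route's ρ0/ρ+): the inviscid tail ratchet
(`stub_inviscid`, ν̂ = 0, `IsEternal`) and the viscous one (`stub_viscous`, ν̂ > 0) compose to the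
crux by `IsEternalVisc.nonneg` and `isEternalVisc_zero_iff`; plus the PLAN-ONLY BC5 rung
`stub_rung_dss` (the crux restricted to exact DSS fronts = a wake floor on `dssMu`, not used in the
composition).
-/

namespace Summit.NavierStokesRegularity.NavierStokesRegularity.Cruxes.TailRatchet.Birth
open Literature.Analysis.FluidPDE.TaoCascade

/-- stub (inviscid tail ratchet, ν̂ = 0): the analytic heart (ρ0 side). -/
theorem stub_inviscid : ∀ R : ℝ, 1 ≤ R → ∃ w : ℝ, 0 < w ∧ ∃ εs : ℝ, 0 < εs ∧ ∀ ε₀ : ℝ, 0 < ε₀ → ε₀ ≤ εs →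
    ∀ α : Fin 4 → Fin 4 → Fin 4 → ℤ × ℤ × ℤ → ℝ, InTableClass R α →
      ∀ W : ℤ → ℝ → Em 4, IsEternal ε₀ α W → UniformBound W →
        ∀ (n : ℤ) (M : ℝ), (∀ σ : ℝ, ∑' k : ℕ, physEnergy ε₀ W (n + k) σ ≤ M) →
          ∀ σ : ℝ, ∑' k : ℕ, physEnergy ε₀ W (n + 1 + k) σ ≤ (1 - w) * M := by
  sorry

/-- stub (viscous tail ratchet, ν̂ > 0): the dissipation-range side (ρ+ side). -/
theorem stub_viscous : ∀ R : ℝ, 1 ≤ R → ∃ w : ℝ, 0 < w ∧ ∃ εs : ℝ, 0 < εs ∧ ∀ ε₀ : ℝ, 0 < ε₀ → ε₀ ≤ εs →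
    ∀ α : Fin 4 → Fin 4 → Fin 4 → ℤ × ℤ × ℤ → ℝ, InTableClass R α →
      ∀ (νh : ℝ) (W : ℤ → ℝ → Em 4), 0 < νh → IsEternalVisc ε₀ νh α W → UniformBound W →
        ∀ (n : ℤ) (M : ℝ), (∀ σ : ℝ, ∑' k : ℕ, physEnergy ε₀ W (n + k) σ ≤ M) →
          ∀ σ : ℝ, ∑' k : ℕ, physEnergy ε₀ W (n + 1 + k) σ ≤ (1 - w) * M := by
  sorry

/-- PLAN-ONLY BC5 rung (not used in the composition): the crux on exact DSS fronts of an
R-comparable table — the per-shell energy ratio of every uniformly bounded inviscid eternal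
solution that is shell-periodic with delay `T` obeys the tail ratchet; technique: travelling-front
profile (delay-differential) energy identity à la Dombre–Gilson + comparable-coupling coercivity. -/
theorem stub_rung_dss : ∀ R : ℝ, 1 ≤ R → ∃ w : ℝ, 0 < w ∧ ∃ εs : ℝ, 0 < εs ∧ ∀ ε₀ : ℝ, 0 < ε₀ → ε₀ ≤ εs →
    ∀ α : Fin 4 → Fin 4 → Fin 4 → ℤ × ℤ × ℤ → ℝ, InTableClass R α →
      ∀ (W : ℤ → ℝ → Em 4) (T : ℝ), IsEternal ε₀ α W → UniformBound W →
        (∀ (n : ℤ) (σ : ℝ), W (n + 1) σ = W n (σ - T)) →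
        ∀ (n : ℤ) (M : ℝ), (∀ σ : ℝ, ∑' k : ℕ, physEnergy ε₀ W (n + k) σ ≤ M) →
          ∀ σ : ℝ, ∑' k : ℕ, physEnergy ε₀ W (n + 1 + k) σ ≤ (1 - w) * M := by
  sorry

/-- Composition lemma (no sorry, unfolded conclusion): the two slices give the tail ratchet, uniformly in ν̂ ≥ 0. -/
theorem tailRatchet_from
    (h0 : ∀ R : ℝ, 1 ≤ R → ∃ w : ℝ, 0 < w ∧ ∃ εs : ℝ, 0 < εs ∧ ∀ ε₀ : ℝ, 0 < ε₀ → ε₀ ≤ εs →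
      ∀ α : Fin 4 → Fin 4 → Fin 4 → ℤ × ℤ × ℤ → ℝ, InTableClass R α →
        ∀ W : ℤ → ℝ → Em 4, IsEternal ε₀ α W → UniformBound W →
          ∀ (n : ℤ) (M : ℝ), (∀ σ : ℝ, ∑' k : ℕ, physEnergy ε₀ W (n + k) σ ≤ M) →
            ∀ σ : ℝ, ∑' k : ℕ, physEnergy ε₀ W (n + 1 + k) σ ≤ (1 - w) * M)
    (h1 : ∀ R : ℝ, 1 ≤ R → ∃ w : ℝ, 0 < w ∧ ∃ εs : ℝ, 0 < εs ∧ ∀ ε₀ : ℝ, 0 < ε₀ → ε₀ ≤ εs →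
      ∀ α : Fin 4 → Fin 4 → Fin 4 → ℤ × ℤ × ℤ → ℝ, InTableClass R α →
        ∀ (νh : ℝ) (W : ℤ → ℝ → Em 4), 0 < νh → IsEternalVisc ε₀ νh α W → UniformBound W →
          ∀ (n : ℤ) (M : ℝ), (∀ σ : ℝ, ∑' k : ℕ, physEnergy ε₀ W (n + k) σ ≤ M) →
            ∀ σ : ℝ, ∑' k : ℕ, physEnergy ε₀ W (n + 1 + k) σ ≤ (1 - w) * M) :
    ∀ R : ℝ, 1 ≤ R → ∃ w : ℝ, 0 < w ∧ ∃ εs : ℝ, 0 < εs ∧ ∀ ε₀ : ℝ, 0 < ε₀ → ε₀ ≤ εs →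
    ∀ α : Fin 4 → Fin 4 → Fin 4 → ℤ × ℤ × ℤ → ℝ, InTableClass R α →
      ∀ (νh : ℝ) (W : ℤ → ℝ → Em 4), IsEternalVisc ε₀ νh α W → UniformBound W →
        ∀ (n : ℤ) (M : ℝ), (∀ σ : ℝ, ∑' k : ℕ, physEnergy ε₀ W (n + k) σ ≤ M) →
          ∀ σ : ℝ, ∑' k : ℕ, physEnergy ε₀ W (n + 1 + k) σ ≤ (1 - w) * M := by
  intro R hR
  obtain ⟨w₀, hw₀, ε₀s, hε₀s, H₀⟩ := h0 R hR
  obtain ⟨w₁, hw₁, ε₁s, hε₁s, H₁⟩ := h1 R hR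
  refine ⟨min w₀ w₁, lt_min hw₀ hw₁, min ε₀s ε₁s, lt_min hε₀s hε₁s, ?_⟩
  intro ε₀ hε₀ hle α hα νh W hW hU n M hM σ
  -- `M ≥ 0`: the tail energy is a sum of non-negative terms
  have hM0 : 0 ≤ M :=
    le_trans (tsum_nonneg fun k : ℕ => physEnergy_nonneg ε₀ W (n + (k : ℤ)) σ) (hM σ)
  rcases hW.nonneg.eq_or_lt with hν | hν
  · -- inviscid slice
    have hW' : IsEternal ε₀ α W := isEternalVisc_zero_iff.1 (hν ▸ hW)
    have := H₀ ε₀ hε₀ (hle.trans (min_le_left _ _)) α hα W hW' hU n M hM σ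
    refine this.trans (mul_le_mul_of_nonneg_right ?_ hM0)
    linarith [min_le_left w₀ w₁]
  · have := H₁ ε₀ hε₀ (hle.trans (min_le_right _ _)) α hα νh W hν hW hU n M hM σ
    refine this.trans (mul_le_mul_of_nonneg_right ?_ hM0)
    linarith [min_le_right w₀ w₁]

/-- THE SKELETON COMPOSITION: the registered stubs, by name, give the crux BY NAME (no sorry outside the stubs). -/
theorem TailRatchet_of :
    Summit.NavierStokesRegularity.NavierStokesRegularity.Theses.WakeRatchet.TailRatchet :=
  tailRatchet_from stub_inviscid stub_viscous

end Summit.NavierStokesRegularity.NavierStokesRegularity.Cruxes.TailRatchet.Birth
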